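import Mathlib.Algebra.Order.Chebyshev
import Mathlib.Data.Real.Basic
import Mathlib.Algebra.Order.BigOperators.Group.Finset
import Mathlib.Algebra.BigOperators.Ring.Finset
import Mathlib.Tactic.Linarith
import Mathlib.Tactic.Positivity
import Mathlib.Tactic.Ring
import Mathlib.Tactic.GCongr
import HarnessLib

/-!
# Summing the phase losses of a 1-ensemble against the Coulomb field (FS82 (2.82)–(2.87))

Support file for the last step of the Fröhlich–Spencer lower bound on the Wilson loop (proof
programme of the named fact
`Literature.MathematicalPhysics.QuantumFieldTheory.FrohlichSpencerU1PerimeterLawD4` and of its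
corollary `Literature.Barriers.QuantumFields.AbelianDeconfinementD4`). After Jensen's inequality
(FS82 (2.79)–(2.80), tree: `FrohlichSpencerCosineLowerBound`), the loss in the exponent is
`∑_{ρ ∈ 𝒩} γ(z(β,ρ)) θ_ρ²` with `θ_ρ = (ε_Λ, μ_ρ)`, and FS82 §2.10 bound it by `d(β) (ε_Λ, ε_Λ)`
((2.87)) through

* (2.82) `|θ_ρ| = |(ε_Λ, μ_ρ)| ≤ max_p |ε_Λ(p)| · max_p |μ_ρ(p)| · card(Ω_ρ)` (`μ_ρ` supported in the
  hypercube `Ω_ρ` of `supp ρ`),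
* (2.84) `max |μ_ρ| ≤ ‖ρ‖₁` (Lemma 1, tree: `CubicalChainsPoincareOne`), (2.85) `card(Ω_ρ) ≤ const L(ρ)⁴`,
* (2.86) `z(β, ρ) ≤ e^{-c(β)‖ρ‖₂²} e^{-c(β) L(ρ)}`,

"We then derive from (2.82)–(2.86) that `∑_{ρ∈𝒩} γ(z(β,ρ)) θ_ρ² ≤ d(β)(ε_Λ, ε_Λ)` for some
finite constant" ((2.87)). This file proves the two pieces of finite-sum bookkeeping behind that
sentence, abstractly (densities `ρ ∈ N`, a "hull" `H ρ` of cells, a field `ε` on cells):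

* `sum_mul_sq_le_of_hull` (**Cauchy–Schwarz and exchange of summations**): if
  `|θ_ρ| ≤ M_ρ ∑_{p ∈ H_ρ} |ε_p|` and, for every cell `p`, `∑_{ρ ∋ p} γ_ρ M_ρ² #H_ρ ≤ D`, then
  `∑_ρ γ_ρ θ_ρ² ≤ D ∑_{p ∈ ⋃ H_ρ} ε_p²`;
* `sum_filter_mem_le_of_count` (**grouping by size**): if `f_ρ ≤ g(L(ρ))` and at most `c(n)`
  densities of size `n` have `p` in their hull, then `∑_{ρ ∋ p} f_ρ ≤ ∑_n g(n) c(n)` — with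
  `g(n) c(n)` summable in `n` (exponential decay of the activities against polynomial counting) the
  constant `D` is independent of the region, which is the content of (2.87).

Everything is proved; no named fact is introduced.

## References

* J. Fröhlich, T. Spencer, Comm. Math. Phys. 83 (1982) 411–454, §2.10 (2.82)–(2.87), p. 432.
  [FrohlichSpencerCMP1982]
-/

noncomputable section

open Finset
open scoped BigOperators

namespace Literature.Probability.LatticeModels

namespace EnsembleExpansion

variable {D P : Type*} [DecidableEq P]

/-- **(2.82)–(2.87), Cauchy–Schwarz and exchange of summations.** For densities `ρ ∈ N` with
hulls `H ρ`, weights `γ ρ ≥ 0`, amplitude bounds `M ρ`, phases `|θ ρ| ≤ M ρ ∑_{p∈H ρ} |ε p|`, and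
the incidence bound `∑_{ρ ∈ N, p ∈ H ρ} γ ρ (M ρ)² #(H ρ) ≤ Dc` at every cell `p`, one has
`∑_{ρ∈N} γ ρ (θ ρ)² ≤ Dc ∑_{p ∈ ⋃_ρ H ρ} (ε p)²`. [cite: FrohlichSpencerCMP1982, §2.10 (2.82)–(2.87) p. 432] -/
theorem sum_mul_sq_le_of_hull (N : Finset D) (H : D → Finset P) (γ M θ : D → ℝ) (ε : P → ℝ)
    (hγ : ∀ ρ ∈ N, 0 ≤ γ ρ) (hθ : ∀ ρ ∈ N, |θ ρ| ≤ M ρ * ∑ p ∈ H ρ, |ε p|) (Dc : ℝ)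
    (hD : ∀ p ∈ N.biUnion H, ∑ ρ ∈ N.filter (fun ρ => p ∈ H ρ), γ ρ * M ρ ^ 2 * (H ρ).card ≤ Dc) :
    ∑ ρ ∈ N, γ ρ * θ ρ ^ 2 ≤ Dc * ∑ p ∈ N.biUnion H, ε p ^ 2 := by
  -- Cauchy–Schwarz: `θ² ≤ M² #H ∑_H ε²`
  have hcs : ∀ ρ ∈ N, θ ρ ^ 2 ≤ M ρ ^ 2 * (H ρ).card * ∑ p ∈ H ρ, ε p ^ 2 := by
    intro ρ hρ
    have h1 : θ ρ ^ 2 ≤ (M ρ * ∑ p ∈ H ρ, |ε p|) ^ 2 := by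
      have := hθ ρ hρ
      have h0 : 0 ≤ M ρ * ∑ p ∈ H ρ, |ε p| := (abs_nonneg _).trans this
      nlinarith [abs_nonneg (θ ρ), sq_abs (θ ρ)]
    have h2 : (∑ p ∈ H ρ, |ε p|) ^ 2 ≤ (H ρ).card * ∑ p ∈ H ρ, |ε p| ^ 2 :=
      sq_sum_le_card_mul_sum_sq
    simp only [sq_abs] at h2
    calc θ ρ ^ 2 ≤ M ρ ^ 2 * (∑ p ∈ H ρ, |ε p|) ^ 2 := by rw [mul_pow] at h1; exact h1
      _ ≤ M ρ ^ 2 * ((H ρ).card * ∑ p ∈ H ρ, ε p ^ 2) := mul_le_mul_of_nonneg_left h2 (sq_nonneg _)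
      _ = M ρ ^ 2 * (H ρ).card * ∑ p ∈ H ρ, ε p ^ 2 := by ring
  -- exchange the summations over the incidence relation
  have hex : ∑ ρ ∈ N, γ ρ * M ρ ^ 2 * (H ρ).card * ∑ p ∈ H ρ, ε p ^ 2 =
      ∑ p ∈ N.biUnion H, ε p ^ 2 * ∑ ρ ∈ N.filter (fun ρ => p ∈ H ρ), γ ρ * M ρ ^ 2 * (H ρ).card := by
    simp_rw [Finset.mul_sum, Finset.sum_filter]
    rw [Finset.sum_comm]
    refine Finset.sum_congr rfl fun ρ hρ => ?_
    rw [← Finset.sum_filter]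
    have : (N.biUnion H).filter (fun p => p ∈ H ρ) = H ρ := by
      ext p
      simp only [Finset.mem_filter, Finset.mem_biUnion]
      exact ⟨fun h => h.2, fun h => ⟨⟨ρ, hρ, h⟩, h⟩⟩
    rw [this]
    exact Finset.sum_congr rfl fun p _ => by ring
  calc ∑ ρ ∈ N, γ ρ * θ ρ ^ 2 ≤ ∑ ρ ∈ N, γ ρ * M ρ ^ 2 * (H ρ).card * ∑ p ∈ H ρ, ε p ^ 2 :=
        Finset.sum_le_sum fun ρ hρ => by
          have := mul_le_mul_of_nonneg_left (hcs ρ hρ) (hγ ρ hρ)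
          linarith
    _ = ∑ p ∈ N.biUnion H, ε p ^ 2 * ∑ ρ ∈ N.filter (fun ρ => p ∈ H ρ), γ ρ * M ρ ^ 2 * (H ρ).card := hex
    _ ≤ ∑ p ∈ N.biUnion H, ε p ^ 2 * Dc :=
        Finset.sum_le_sum fun p hp => mul_le_mul_of_nonneg_left (hD p hp) (sq_nonneg _)
    _ = Dc * ∑ p ∈ N.biUnion H, ε p ^ 2 := by rw [Finset.mul_sum]; exact Finset.sum_congr rfl fun p _ => by ring

/-- **(2.87), grouping by size.** If `0 ≤ f ρ ≤ g (L ρ)` with `g ≥ 0`, the sizes of the densities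
lie in `S`, and for every `n` at most `c n` densities `ρ ∈ N` of size `L ρ = n` have the cell `p` in
their hull, then `∑_{ρ ∈ N, p ∈ H ρ} f ρ ≤ ∑_{n ∈ S} g n · c n`. [cite: FrohlichSpencerCMP1982, §2.10 (2.85)–(2.87) p. 432] -/
theorem sum_filter_mem_le_of_count (N : Finset D) (H : D → Finset P) (L : D → ℕ) (f : D → ℝ)
    (g c : ℕ → ℝ) (hf : ∀ ρ ∈ N, 0 ≤ f ρ ∧ f ρ ≤ g (L ρ)) (hg : ∀ n, 0 ≤ g n) (p : P)
    (hcount : ∀ n, ((N.filter fun ρ => p ∈ H ρ).filter fun ρ => L ρ = n).card ≤ c n)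
    (S : Finset ℕ) (hS : ∀ ρ ∈ N, L ρ ∈ S) :
    ∑ ρ ∈ N.filter (fun ρ => p ∈ H ρ), f ρ ≤ ∑ n ∈ S, g n * c n := by
  set F := N.filter fun ρ => p ∈ H ρ with hF
  have hFN : F ⊆ N := Finset.filter_subset _ _
  calc ∑ ρ ∈ F, f ρ ≤ ∑ ρ ∈ F, g (L ρ) := Finset.sum_le_sum fun ρ hρ => (hf ρ (hFN hρ)).2
    _ = ∑ n ∈ S, ∑ ρ ∈ F.filter (fun ρ => L ρ = n), g (L ρ) :=
        (Finset.sum_fiberwise_of_maps_to (fun ρ hρ => hS ρ (hFN hρ)) _).symm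
    _ = ∑ n ∈ S, g n * ((F.filter fun ρ => L ρ = n).card : ℝ) := by
        refine Finset.sum_congr rfl fun n _ => ?_
        rw [Finset.sum_congr rfl fun ρ hρ => by rw [(Finset.mem_filter.1 hρ).2], Finset.sum_const,
          nsmul_eq_mul, mul_comm]
    _ ≤ ∑ n ∈ S, g n * c n :=
        Finset.sum_le_sum fun n _ => mul_le_mul_of_nonneg_left (hcount n) (hg n)

/-- The two steps combined: the constant of (2.87) is `∑_{n∈S} g n · c n`.
[cite: FrohlichSpencerCMP1982, §2.10 (2.87) p. 432] -/
theorem sum_mul_sq_le_of_count (N : Finset D) (H : D → Finset P) (L : D → ℕ) (γ M θ : D → ℝ)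
    (ε : P → ℝ) (g c : ℕ → ℝ) (S : Finset ℕ) (hγ : ∀ ρ ∈ N, 0 ≤ γ ρ)
    (hθ : ∀ ρ ∈ N, |θ ρ| ≤ M ρ * ∑ p ∈ H ρ, |ε p|)
    (hf : ∀ ρ ∈ N, γ ρ * M ρ ^ 2 * (H ρ).card ≤ g (L ρ)) (hg : ∀ n, 0 ≤ g n)
    (hcount : ∀ p n, ((N.filter fun ρ => p ∈ H ρ).filter fun ρ => L ρ = n).card ≤ c n)
    (hS : ∀ ρ ∈ N, L ρ ∈ S) :
    ∑ ρ ∈ N, γ ρ * θ ρ ^ 2 ≤ (∑ n ∈ S, g n * c n) * ∑ p ∈ N.biUnion H, ε p ^ 2 := by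
  refine sum_mul_sq_le_of_hull N H γ M θ ε hγ hθ _ fun p _ => ?_
  refine sum_filter_mem_le_of_count N H L (fun ρ => γ ρ * M ρ ^ 2 * (H ρ).card) g c
    (fun ρ hρ => ⟨?_, hf ρ hρ⟩) hg p (hcount p) S hS
  have := hγ ρ hρ
  positivity

end EnsembleExpansion

end Literature.Probability.LatticeModels
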